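import Literature.MathematicalPhysics.QuantumLattice.AbelianFluxSectorsProofs
import HarnessLib

/-!
# The index trace formula `Tr Γ₅(1 − ½D₀) = N₋(H) − ½ dim` for the overlap operator

Topic `Literature/MathematicalPhysics/QuantumLattice`; namespace `Literature.MathematicalPhysics.QuantumLattice`.
Step (G) of the finite-volume index formula `IOSFluxSectorIndex` (`AbelianFluxSectors.lean`): the identification of
the anomaly sum `Σ_x tr γ₅(1 − ½D(x,x)) = Tr Γ₅(1 − ½D₀)` of the massless overlap operator
`D₀ = 1 + V = 1 + Γ₅ ε(H)` (`OverlapDirac.lean`: `overlapDirac ρ U m₀ 0`, `overlapKernel`, `overlapUnitary`) with the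
spectral asymmetry of the Hermitian Wilson kernel `H = Γ₅ D_W(U, −m₀, 1)`:
[Fujiwara2002SpectralFlow, (2.2)] "`index D = Tr γ₅(1 − ½D) = −½ Tr (H/√H²)`", i.e. `= N₋(H) − ½ dim` off the
exceptional set `det H = 0` (the spectral index `Q = n₋ − n/2` of `Literature.Barriers.QuantumFields.WilsonDeterminantSign`,
there DEFINED spectrally with the identification cited — here the identification with `Tr Γ₅(1 − ½D₀)` is PROVED).

* `trace_cfc_sign_eq` — for an invertible Hermitian matrix `tr sign(A) = dim − 2N₋(A)` (`N₋` = negative roots of the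
  characteristic polynomial with multiplicity = negative eigenvalues, `countP_neg_roots_charpoly_eq_card_neg_eigenvalues`);
* `trace_spinorLift_gammaFive` — `Tr Γ₅ = 0`;
* `trace_gammaFive_mul_one_sub_half_overlapDirac_zero` — **`Tr Γ₅(1 − ½D₀) = N₋(H) − ½ dim`** for unitary `ρ`,
  `det H ≠ 0` (`Γ₅(1 − ½(1 + Γ₅ε)) = ½Γ₅ − ½ε`);
* `trace_index_fluxSectorField` — for the unit-charge fermion in Lüscher's flux-sector field `V_{[m]}` under the
  hypothesis of `IOSFluxSectorIndex` (where `det H ≠ 0` is the tree theorem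
  `det_gammaFive_mul_wilsonDirac_fluxSectorField_ne_zero`): `Tr Γ₅(1 − ½D₀) = N₋ − 2L⁴`, the integer that
  [IgarashiOkuyamaSuzuki2002, (2.3), Thm 3.1, (3.4)] evaluates as `𝒩 (m₀₁m₂₃ − m₀₂m₁₃ + m₀₃m₁₂)`.

Not here: the Hasenfratz–Laliena–Niedermayer zero-mode count `n₊ − n₋ = Tr Γ₅(1 − ½D₀)` (not needed for
`IOSFluxSectorIndex`, whose statement is spectral) and, of course, the evaluation of the index (Lüscher's
classification theorem and the continuum coefficient are not in the tree).

## References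
* T. Fujiwara, Prog. Theor. Phys. 107 (2002) 163–175, arXiv:hep-lat/0012007, eq. (2.2). [Fujiwara2002SpectralFlow]
* H. Igarashi, K. Okuyama, H. Suzuki, Nucl. Phys. B 644 (2002) 383–394, arXiv:hep-lat/0206003, (2.1)–(2.3). [IgarashiOkuyamaSuzuki2002]
* H. Neuberger, Phys. Lett. B 417 (1998) 141. [Neuberger1998]
-/

noncomputable section

open Matrix Finset
open scoped Kronecker
open Literature.Probability.LatticeModels (TorusSite)
open Literature.MathematicalPhysics.QuantumFieldTheory

namespace Literature.MathematicalPhysics.QuantumLattice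

/-! ### The trace of the sign function -/

section Sign

variable {n : Type*} [Fintype n] [DecidableEq n]

/-- For a Hermitian matrix, the negative roots of the characteristic polynomial (with multiplicity)
are counted by the negative eigenvalues. [folklore] -/
theorem countP_neg_roots_charpoly_eq_card_neg_eigenvalues {A : Matrix n n ℂ} (hA : A.IsHermitian) :
    A.charpoly.roots.countP (fun z => z.re < 0) =
      (Finset.univ.filter fun i => hA.eigenvalues i < 0).card := by
  rw [hA.roots_charpoly_eq_eigenvalues, Multiset.countP_map]
  simp only [Function.comp_apply]
  rw [← Finset.filter_val, Finset.card_val]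
  rfl

/-- The trace is invariant under conjugation by the eigenvector unitary: `tr (U D U⋆) = tr D`. [folklore] -/
theorem trace_unitary_conj {U : Matrix n n ℂ} (hU : U ∈ Matrix.unitaryGroup n ℂ) (D : Matrix n n ℂ) :
    (U * D * star U).trace = D.trace := by
  rw [Matrix.trace_mul_cycle, Matrix.mem_unitaryGroup_iff'.mp hU, Matrix.one_mul]

/-- **Trace of the matrix sign**: for an invertible Hermitian matrix,
`tr sign(A) = #{λ > 0} − #{λ < 0} = dim − 2 N₋(A)`. [folklore] -/
theorem trace_cfc_sign_eq {A : Matrix n n ℂ} (hA : A.IsHermitian) (hdet : A.det ≠ 0) :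
    (cfc Real.sign A).trace =
      (Fintype.card n : ℂ) - 2 * (A.charpoly.roots.countP (fun z => z.re < 0) : ℂ) := by
  have h0 : ∀ i, hA.eigenvalues i ≠ 0 := by
    intro i hi
    apply hdet
    rw [hA.det_eq_prod_eigenvalues]
    exact Finset.prod_eq_zero (Finset.mem_univ i) (by simp [hi])
  rw [hA.cfc_eq, Matrix.IsHermitian.cfc, Unitary.conjStarAlgAut_apply,
    trace_unitary_conj hA.eigenvectorUnitary.2, Matrix.trace_diagonal,
    countP_neg_roots_charpoly_eq_card_neg_eigenvalues hA]
  simp only [Function.comp_apply]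
  have hsign : ∀ i, (RCLike.ofReal (Real.sign (hA.eigenvalues i)) : ℂ) =
      1 - 2 * (if hA.eigenvalues i < 0 then (1 : ℂ) else 0) := by
    intro i
    rcases lt_or_gt_of_ne (h0 i) with h | h
    · rw [Real.sign_of_neg h, if_pos h]; push_cast; ring
    · rw [Real.sign_of_pos h, if_neg (not_lt.mpr h.le)]; push_cast; ring
  simp_rw [hsign, Finset.sum_sub_distrib, Finset.sum_const, Finset.card_univ, nsmul_eq_mul, mul_one,
    ← Finset.mul_sum, Finset.sum_boole]

end Sign

/-! ### The index trace formula for the overlap operator -/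

section Index

/-- `tr γ₅ = 0`. [folklore] -/
theorem trace_gammaFive : gammaFive.trace = 0 := by
  rw [gammaFive_eq_diagonal, Matrix.trace_diagonal]
  simp [Fin.sum_univ_four]

/-- `Tr Γ₅ = 0` on site × colour × spin. [folklore] -/
theorem trace_spinorLift_gammaFive {L N : ℕ} [NeZero L] :
    (spinorLift gammaFive :
      Matrix (TorusSite 4 L × Fin N × Fin 4) (TorusSite 4 L × Fin N × Fin 4) ℂ).trace = 0 := by
  rw [spinorLift, Matrix.trace_kronecker, Matrix.trace_kronecker, trace_gammaFive, mul_zero, mul_zero]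

variable {L N : ℕ} [NeZero L] {G : Type*} [Group G] (ρ : G →* Matrix (Fin N) (Fin N) ℂ)

/-- **The index trace formula** (Fujiwara 2002 (2.2); Hasenfratz–Laliena–Niedermayer / Lüscher 1998): off the
exceptional set `det H = 0`, the "topological charge" `Tr Γ₅(1 − ½D₀) = −½ Tr ε(H)` of the massless overlap
operator `D₀ = 1 + Γ₅ ε(H)` equals `N₋(H) − ½ dim`, where `N₋(H)` is the number of negative eigenvalues of the
Hermitian Wilson kernel `H = Γ₅ D_W(U, −m₀, 1)` counted with multiplicity (as roots of the characteristic
polynomial). [cite: Fujiwara2002SpectralFlow, eq. (2.2)] -/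
theorem trace_gammaFive_mul_one_sub_half_overlapDirac_zero
    (hρ : ∀ g, ρ g ∈ Matrix.unitaryGroup (Fin N) ℂ) (U : GaugeConfig 4 L G) (m₀ : ℝ)
    (hdet : (overlapKernel ρ U m₀).det ≠ 0) :
    (spinorLift gammaFive * (1 - (2⁻¹ : ℂ) • overlapDirac ρ U m₀ 0)).trace =
      ((overlapKernel ρ U m₀).charpoly.roots.countP (fun z : ℂ => z.re < 0) : ℂ) -
        (Fintype.card (TorusSite 4 L × Fin N × Fin 4) : ℂ) / 2 := by
  have hΓΓ := spinorLift_gammaFive_mul_self (L := L) (N := N)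
  rw [overlapDirac_zero, overlapUnitary]
  -- Γ₅ (1 − ½(1 + Γ₅ ε)) = ½ Γ₅ − ½ ε
  have halg : spinorLift gammaFive * (1 - (2⁻¹ : ℂ) • (1 + spinorLift gammaFive * cfc Real.sign (overlapKernel ρ U m₀))) =
      (2⁻¹ : ℂ) • spinorLift gammaFive - (2⁻¹ : ℂ) • cfc Real.sign (overlapKernel ρ U m₀) := by
    rw [smul_add, Matrix.mul_sub, Matrix.mul_add, Matrix.mul_one, Matrix.mul_smul, Matrix.mul_one,
      Matrix.mul_smul, ← Matrix.mul_assoc, hΓΓ, Matrix.one_mul]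
    module
  rw [halg, Matrix.trace_sub, Matrix.trace_smul, Matrix.trace_smul, trace_spinorLift_gammaFive,
    trace_cfc_sign_eq (overlapKernel_isHermitian ρ hρ U m₀) hdet]
  simp only [smul_eq_mul, mul_zero, zero_sub]
  ring

/-- **The index of the unit-charge overlap operator in Lüscher's flux-sector field**: under the
hypothesis of `IOSFluxSectorIndex`, `Σ_x tr γ₅(1 − ½D₀)(x,x) = N₋(Γ₅ D_W(V_{[m]}, −1, 1)) − 2L⁴` — the quantity
the Igarashi–Okuyama–Suzuki theorem evaluates as `𝒩·(m₀₁m₂₃ − m₀₂m₁₃ + m₀₃m₁₂)`. [cite: IgarashiOkuyamaSuzuki2002, (2.1) and (2.3)] -/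
theorem trace_index_fluxSectorField (m : Fin 4 → Fin 4 → ℤ) (hm : ∀ μ ν, m ν μ = -m μ ν)
    (hb : ∀ μ ν, 2 * Real.pi * |(m μ ν : ℝ)| ≤ (L : ℝ) ^ 2 / 50) :
    (spinorLift gammaFive * (1 - (2⁻¹ : ℂ) • overlapDirac u1Rep (fluxSectorField L m) 1 0)).trace =
      ((spinorLift gammaFive * wilsonDirac u1Rep (fluxSectorField L m) (-1) 1).charpoly.roots.countP
          (fun z : ℂ => z.re < 0) : ℂ) - 2 * (L : ℂ) ^ 4 := by
  rw [trace_gammaFive_mul_one_sub_half_overlapDirac_zero u1Rep u1Rep_mem_unitaryGroup _ 1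
    (by rw [overlapKernel_fluxSectorField_one]
        exact det_gammaFive_mul_wilsonDirac_fluxSectorField_ne_zero m hm hb),
    overlapKernel_fluxSectorField_one]
  simp only [Fintype.card_prod, Fintype.card_pi, ZMod.card, Finset.prod_const, Finset.card_univ,
    Fintype.card_fin]
  push_cast
  ring

end Index

end Literature.MathematicalPhysics.QuantumLattice

end
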